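import Summits.ValiantsHypothesis.ValiantsHypothesis.Theorems.GrenetZeonDualUnipotentThreeHalvesLongMassNilSpaceWords
import Summits.ValiantsHypothesis.ValiantsHypothesis.Theorems.GrenetZeonTwoDimCoefficientsDualUnipotentDualCharpoly

/-!
# `GrenetZeon.DualUnipotentThreeHalves` (stmt-ValiantsHypothesis-24318), line `slow_core`, stub (c) `SlowCore.LongMassSlowLawInv`:
# ONE-LETTER WORDS ARE DERIVATIVES — the order-`(H − 3)` window criterion in closed form

Sequel to ✓ `…LongMassNilSpaceWords` (§4 there: the deep mode lives strictly below length `H`; `window_order_sub_three_iff` in word form).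
Here the two word sums that occur at order `H − 3` are identified in closed form:

* ★ `oneA_words_eq_sum` / `oneLetterA_words_eq_sum` — the sum of the words of length `p` with exactly ONE letter `A` (all others `w`) is the
  first-order sum `Σ_{i<p} w^i · A · w^{p−1−i}` (= the `ε`-part of `(w + εA)^p`, ✓ `DualCharpoly.dualLift_pow_map_snd`, read through the word
  expansion ✓ `add_smul_pow_eq_sum_words` over `ℂ[ε]/ε²`; the second form is the WINDOW convention of ✓ `window_iff_mixedWords`, `true` = letter `w`,
  reached by the involution `ε ↦ ¬ε`);
* ★ `pureWords_eq_pow` — the pure word sum is `w^p`;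
* ★★★ `window_order_sub_three_iff_powDeriv` — **ORDER `H − 3` IN CLOSED FORM**: for a nil space `V ≤ M_b(ℂ)` of uniform index `≤ H`
  (`3 ≤ H ≤ n`) and `W ≤ V`, `(W, H − 3)` is a window pair at window `n` IFF every `w ∈ W` satisfies
  `w^{H−2} = 0` and `Σ_{i+j=H−2} w^i · A · w^j = 0` for all `A ∈ V` —
  i.e. `W` lies in the zero set of the power map `P_{H−2}` and in the CRITICAL locus of `P_{H−1} : X ↦ X^{H−1}` restricted to `V`
  (the differential `dP_{H−1}(w)[A] = Σ w^i A w^{H−2−i}` vanishes in every direction `A ∈ V`).  One step below U2♭ (✓ `window_of_pow_succ_eq_zero`,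
  pure index condition) the deep mode enters through exactly ONE linear-in-`A` condition.

HONEST FRAMING.  Dictionary entries (`--supports stmt-ValiantsHypothesis-24318`); NOT progress on (c) `SlowCore.LongMassSlowLawInv` (RESEARCH — OPEN);
closes no stub; S3, 24318, 8062 and `VP ≠ VNP` are NOT proved.  Def-free, no named facts, no sorry.
-/

set_option linter.dupNamespace false
set_option autoImplicit false

noncomputable section

namespace Summit.ValiantsHypothesis.ValiantsHypothesis.Theorems.GrenetZeon.NilSpaceWords

open MvPolynomial Matrix TrivSqZeroExt
open scoped BigOperators
open Summit.ValiantsHypothesis.ValiantsHypothesis.Theorems.GrenetZeon.LongMassHomogenise (add_smul_pow_eq_sum_words)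
open Summit.ValiantsHypothesis.ValiantsHypothesis.Cruxes.TwoDimCoefficients.DimTwoCases.DualCharpoly (dualLift_pow_map_snd eps_mul_inl)

variable {b : ℕ}

/-- Words over the dual numbers: a word in `inl`-images is the `inl`-image of the word. -/
theorem word_map_inl (A w : Matrix (Fin b) (Fin b) ℂ) {p : ℕ} (δ : Fin p → Bool) :
    (List.ofFn fun i => if δ i then A.map (inl : ℂ → DualNumber ℂ) else w.map inl).prod =
      ((List.ofFn fun i => if δ i then A else w).prod).map (inl : ℂ → DualNumber ℂ) := by
  have hmap : ∀ M : Matrix (Fin b) (Fin b) ℂ,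
      M.map (inl : ℂ → DualNumber ℂ) = (TrivSqZeroExt.inlHom ℂ ℂ : ℂ →+* DualNumber ℂ).mapMatrix M := fun M => rfl
  simp only [hmap]
  rw [map_list_prod, List.map_ofFn]
  congr 1
  refine List.ofFn_inj.mpr (funext fun i => ?_)
  simp only [Function.comp]
  split_ifs <;> rfl

/-- `ε`-parts of powers of `ε`: `snd (ε^k) = [k = 1]`. -/
theorem snd_eps_pow (k : ℕ) : snd ((DualNumber.eps : DualNumber ℂ) ^ k) = if k = 1 then (1 : ℂ) else 0 := by
  rcases k with _ | _ | k
  · simp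
  · simp
  · rw [pow_succ, pow_succ, mul_assoc, DualNumber.eps_mul_eps, mul_zero, snd_zero, if_neg (by omega)]

/-- ★ **ONE-`A` WORDS ARE THE FIRST-ORDER SUM**: `Σ_{δ : exactly one letter A} Π_i (if δ i then A else w) = Σ_{i<p} w^i · A · w^{p−1−i}`. -/
theorem oneA_words_eq_sum (A w : Matrix (Fin b) (Fin b) ℂ) (p : ℕ) :
    (∑ δ ∈ (Finset.univ : Finset (Fin p → Bool)).filter (fun δ => (∑ i, if δ i then 1 else 0) = 1),
        (List.ofFn fun i => if δ i then A else w).prod) = ∑ i ∈ Finset.range p, w ^ i * A * w ^ (p - 1 - i) := by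
  classical
  have hexp := add_smul_pow_eq_sum_words (w.map (inl : ℂ → DualNumber ℂ)) (A.map inl) (DualNumber.eps : DualNumber ℂ) p
  have hεA : (DualNumber.eps : DualNumber ℂ) • A.map (inl : ℂ → DualNumber ℂ) = A.map inr := by
    refine Matrix.ext fun i j => ?_
    rw [Matrix.smul_apply, Matrix.map_apply, Matrix.map_apply, smul_eq_mul, eps_mul_inl]
  rw [hεA] at hexp
  refine Matrix.ext fun i j => ?_
  -- ε-part of the (i,j) entry of both sides of the expansion
  have hL : snd ((((w.map (inl : ℂ → DualNumber ℂ) + A.map (inr : ℂ → DualNumber ℂ)) ^ p :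
      Matrix (Fin b) (Fin b) (DualNumber ℂ)) i j)) =
      (∑ l ∈ Finset.range p, w ^ l * A * w ^ (p - 1 - l)) i j := by
    have h := dualLift_pow_map_snd w A p
    have h' := congr_fun (congr_fun h i) j
    rwa [Matrix.map_apply] at h'
  rw [← hL, hexp, Matrix.sum_apply, Matrix.sum_apply, snd_sum, Finset.sum_filter]
  refine Finset.sum_congr rfl fun δ _ => ?_
  simp only [Matrix.smul_apply, word_map_inl, Matrix.map_apply, smul_eq_mul, snd_mul, fst_inl, snd_inl,
    snd_eps_pow, op_smul_eq_mul]
  split_ifs <;> simp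

/-- Complementary letter counts: `#(¬ε) + #ε = p`. -/
theorem count_not_add_count (p : ℕ) (ε : Fin p → Bool) :
    (∑ i, if (!ε i) then 1 else 0) + (∑ i, if ε i then 1 else 0) = p := by
  rw [← Finset.sum_add_distrib]
  have h1 : ∀ i : Fin p, ((if (!ε i) = true then 1 else 0) + (if ε i = true then 1 else 0)) = 1 := fun i => by
    cases ε i <;> simp
  simp_rw [h1]
  simp

/-- ★ The same in the WINDOW convention of ✓ `window_iff_mixedWords` (`true` marks the letter `w`): for `p ≥ 1`, the sum of the words of length `p`
with exactly `p − 1` letters `w` (one letter `A`) is `Σ_{i<p} w^i · A · w^{p−1−i}`. -/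
theorem oneLetterA_words_eq_sum (A w : Matrix (Fin b) (Fin b) ℂ) (p : ℕ) (hp : 1 ≤ p) :
    (∑ ε ∈ (Finset.univ : Finset (Fin p → Bool)).filter (fun ε => (∑ i, if ε i then 1 else 0) = p - 1),
        (List.ofFn fun i => if ε i then w else A).prod) = ∑ i ∈ Finset.range p, w ^ i * A * w ^ (p - 1 - i) := by
  classical
  rw [← oneA_words_eq_sum A w p, Finset.sum_filter, Finset.sum_filter]
  set σ : Equiv.Perm (Fin p → Bool) :=
    Function.Involutive.toPerm (fun ε : Fin p → Bool => fun i => !ε i) (fun ε => by funext i; simp) with hσ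
  set G : (Fin p → Bool) → Matrix (Fin b) (Fin b) ℂ := fun δ =>
    if (∑ i, if δ i then 1 else 0) = 1 then (List.ofFn fun i => if δ i then A else w).prod else 0 with hG
  calc (∑ ε : Fin p → Bool, if (∑ i, if ε i then 1 else 0) = p - 1 then (List.ofFn fun i => if ε i then w else A).prod else 0)
      = ∑ ε : Fin p → Bool, G (σ ε) := by
        refine Finset.sum_congr rfl fun ε _ => ?_
        have hcount := count_not_add_count p ε
        have hword : (List.ofFn fun i => if (σ ε) i then A else w) = (List.ofFn fun i => if ε i then w else A) := by
          refine List.ofFn_inj.mpr (funext fun i => ?_)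
          show (if (!ε i) = true then A else w) = (if ε i = true then w else A)
          cases ε i <;> simp
        have hcnt : ((∑ i, if (σ ε) i then 1 else 0) = 1) ↔ ((∑ i, if ε i then 1 else 0) = p - 1) := by
          show ((∑ i, if (!ε i) = true then 1 else 0) = 1) ↔ _
          omega
        simp only [hG, hword]
        by_cases h : (∑ i, if ε i then 1 else 0) = p - 1
        · rw [if_pos h, if_pos (hcnt.mpr h)]
        · rw [if_neg h, if_neg (fun h' => h (hcnt.mp h'))]
    _ = ∑ δ : Fin p → Bool, G δ := Equiv.sum_comp σ G
    _ = _ := by rfl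

/-- ★ The PURE word sum (all letters `w`) is `w^p`. -/
theorem pureWords_eq_pow (A w : Matrix (Fin b) (Fin b) ℂ) (p : ℕ) :
    (∑ ε ∈ (Finset.univ : Finset (Fin p → Bool)).filter (fun ε => (∑ i, if ε i then 1 else 0) = p),
        (List.ofFn fun i => if ε i then w else A).prod) = w ^ p := by
  classical
  have hfilter : ((Finset.univ : Finset (Fin p → Bool)).filter fun ε => (∑ i, if ε i then 1 else 0) = p) =
      {fun _ => true} := by
    ext ε
    simp only [Finset.mem_filter, Finset.mem_univ, true_and, Finset.mem_singleton]
    constructor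
    · exact eq_true_of_count_eq p ε
    · rintro rfl; simp
  rw [hfilter, Finset.sum_singleton]
  simp [List.ofFn_const, List.prod_replicate]

/-! ## The order-`(H − 3)` criterion in closed form -/

/-- ★★★ **ORDER `H − 3` IN CLOSED FORM.**  For a nil space `V` of uniform index `≤ H` with `3 ≤ H ≤ n` and `W ≤ V`:
`(W, H − 3)` is a window pair of `V` at window `n` iff every `w ∈ W` has `w^{H−2} = 0` and `Σ_{i<H−1} w^i · A · w^{H−2−i} = 0` for all `A ∈ V`. -/
theorem window_order_sub_three_iff_powDeriv (V W : Submodule ℂ (Matrix (Fin b) (Fin b) ℂ)) {H : ℕ} (n : ℕ)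
    (hV : ∀ X ∈ V, X ^ H = 0) (hWV : W ≤ V) (hH : 3 ≤ H) (hn : H ≤ n) :
    (∀ A ∈ V, ∀ w ∈ W, ∀ p : ℕ, p ≤ n - 1 → ∀ i j : Fin b,
      ((((A.map (C : ℂ → MvPolynomial (Fin 1) ℂ) + (X 0 : MvPolynomial (Fin 1) ℂ) • w.map C) ^ p :
        Matrix (Fin b) (Fin b) (MvPolynomial (Fin 1) ℂ)) i j).totalDegree ≤ H - 3)) ↔
    (∀ w ∈ W, w ^ (H - 2) = 0 ∧ ∀ A ∈ V, (∑ i ∈ Finset.range (H - 1), w ^ i * A * w ^ (H - 2 - i)) = 0) := by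
  classical
  rw [window_order_sub_three_iff V W n hV hWV hH hn]
  have hone : ∀ A w : Matrix (Fin b) (Fin b) ℂ,
      (∑ ε ∈ (Finset.univ : Finset (Fin (H - 1) → Bool)).filter (fun ε => (∑ i, if ε i then 1 else 0) = H - 1 - 1),
        (List.ofFn fun i => if ε i then w else A).prod) = ∑ i ∈ Finset.range (H - 1), w ^ i * A * w ^ (H - 2 - i) := by
    intro A w
    rw [oneLetterA_words_eq_sum A w (H - 1) (by omega)]
    exact Finset.sum_congr rfl fun i _ => by rw [show H - 1 - 1 - i = H - 2 - i by omega]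
  constructor
  · intro h w hw
    refine ⟨?_, fun A hA => ?_⟩
    · have h1 := h 0 V.zero_mem w hw (H - 2) le_rfl (by omega) (H - 2) (by omega)
      rwa [pureWords_eq_pow] at h1
    · have h1 := h A hA w hw (H - 1) (by omega) (by omega) (H - 1 - 1) (by omega)
      rwa [hone] at h1
  · intro h A hA w hw p hp hpH q hq
    obtain ⟨hw2, hder⟩ := h w hw
    by_cases hqp : p < q
    · rw [Finset.filter_false_of_mem, Finset.sum_empty]
      intro ε _ hε
      have := count_true_le p ε
      omega
    · rcases Nat.lt_or_ge p (H - 1) with hp' | hp'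
      · -- `p = H − 2 = q`: the pure word
        have hpq : p = q := by omega
        subst hpq
        rw [pureWords_eq_pow, show p = H - 2 by omega, hw2]
      · -- `p = H − 1`, `q ∈ {H − 2, H − 1}`
        have hp1 : p = H - 1 := by omega
        subst hp1
        rcases Nat.lt_or_ge q (H - 1) with hq' | hq'
        · rw [show q = H - 1 - 1 by omega, hone]
          exact hder A hA
        · rw [show q = H - 1 by omega, pureWords_eq_pow, show H - 1 = H - 2 + 1 by omega, pow_succ, hw2, Matrix.zero_mul]

end Summit.ValiantsHypothesis.ValiantsHypothesis.Theorems.GrenetZeon.NilSpaceWords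

end
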